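import Summits.QuantumFields.YangMills.Theorems.FlatTubeReductionPinnedSpanStepDefs
import Summits.QuantumFields.YangMills.Theorems.FlatTubeReductionUnitLadder
import HarnessLib

/-!
# Route `FlatTubeReduction` (LINE g6-A «unit-slab ladder») — DOORS of the momentum-covariant pinned engines
# (bear on crux `UnitUpStep` stmt-QuantumFields-27556 and the shared crux `UpStepEv` stmt-QuantumFields-26796; R2b1 RECORD rung — no summit)

Seat ym-line-fcl-p3 g11 (2026-08-28).  For the Props of `Theorems/FlatTubeReductionPinnedSpanStepDefs.lean`:
* `PinnedSpan.isPhys_sum_mul`, `PinnedSpan.isPhys_spanSum`, ★ `PinnedSpan.isPhys_spanTrial` — every member of the momentum-covariant trial family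
  `spanTrial L′ a (φ′/Ω′) Ω` is a physical zero-flux test function (finite real combinations of `Thinning.isPhys_thin_shift`, dressed by `Ω` via
  `IsPhys.mul_of_invariant`);
* ★★ `PinnedSpan.unitUpStep_of_pinnedSpanUnitStep : PinnedSpanUnitStep → UnitUpStep` and
  ★★ `PinnedSpan.upStepEv_of_pinnedSpanUpStep : PinnedSpanUpStep → UpStepEv` (+ the `FemtoCutoffLadder` copy) — the min–max door of
  `UnitLadder.unitUpStep_of_pinnedUnitStepEx` / `upStepEv_of_pinnedUpStepEx` run on the trial `ψ_a` handed over by the hypothesis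
  (`UpStep.recentred_moments`, `UpStep.l2_iterate_le_pow_secondValue`): the coefficients `a` and the momentum content of `φ′` are irrelevant to the door;
* ★ `PinnedSpan.pinnedSpanUnitStep_of_pinnedUnitStepEx : PinnedUnitStepEx → PinnedSpanUnitStep`,
  ★ `PinnedSpan.pinnedSpanUpStep_of_pinnedUpStepEx : PinnedUpStepEx → PinnedSpanUpStep` — the filed engines (27561, 27379; plain average
  `a ≡ |Λ_L|⁻¹`) are the STRONGER statements (restrict-then-tighten equivalence rule: every `--supports` result of the old lines transfers).
HONEST FRAMING: glue only; the analytic content (one-sided two-cutoff autocorrelation comparison of the pinned coarse excitation, XL,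
`UVStabilityNonUniqueness` class) is OPEN.  Nothing here concerns infinite volume, the continuum limit or the Clay Yang–Mills mass gap.
References: M. Lüscher, NPB 219 (1983) 233 [cite: Luscher1983, §3]; T. Balaban, CMP 98 (1985) 17 [cite: Balaban1985Averaging, §1].
-/

set_option autoImplicit false

noncomputable section

open MeasureTheory
open Literature.MathematicalPhysics.QuantumFieldTheory (Site Edge GaugeConfig gaugeTransform torusConfigShift torusConfigShift_apply)
open Literature.MathematicalPhysics.QuantumLattice

namespace Summit.QuantumFields.YangMills.Theorems.FlatTubeReduction.PinnedSpan

open Summit.QuantumFields.YangMills.Theorems.FemtoTransferGap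
open Summit.QuantumFields.YangMills.Theses.FlatTubeReduction
open Summit.QuantumFields.YangMills.Theorems.FemtoCutoffLadder
open Summit.QuantumFields.YangMills.Theorems.FemtoCutoffLadder.Thinning (thin)

/-! ## The trial family is physical -/

/-- Finite real combinations of physical zero-flux test functions are physical. [folklore] -/
theorem isPhys_sum_mul {L : ℕ} {ι : Type*} (s : Finset ι) (ψ : ι → GaugeConfig 3 L SU2 → ℝ) (hψ : ∀ i, IsPhys (ψ i)) (a : ι → ℝ) :
    IsPhys (fun U => ∑ i ∈ s, a i * ψ i U) := by
  classical
  induction s using Finset.induction_on with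
  | empty =>
    have e : (fun U : GaugeConfig 3 L SU2 => ∑ i ∈ (∅ : Finset ι), a i * ψ i U) = fun _ => (0 : ℝ) := by funext U; simp
    rw [e]; exact isPhys_const 0
  | insert j s hj ih =>
    have e : (fun U => ∑ i ∈ insert j s, a i * ψ i U) = (a j • ψ j) + fun U => ∑ i ∈ s, a i * ψ i U := by
      funext U; simp [Finset.sum_insert hj]
    rw [e]; exact ((hψ j).smul (a j)).add ih

/-- The momentum-covariant sum `U ↦ Σ_v a v · g(thin L′ (τ_v U))` of a physical coarse `g` is physical on the fine torus (`L′ ≤ L ≤ 2L′`).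
[cite: Luscher1983, §2] -/
theorem isPhys_spanSum {L L' : ℕ} [NeZero L] [NeZero L'] (hLL : L' ≤ L) (h2 : L ≤ 2 * L') {g : GaugeConfig 3 L' SU2 → ℝ}
    (hg : IsPhys g) (a : Site 3 L → ℝ) :
    IsPhys (fun U : GaugeConfig 3 L SU2 => ∑ v : Site 3 L, a v * g (thin L' (torusConfigShift v U))) :=
  isPhys_sum_mul Finset.univ (fun v U => g (thin L' (torusConfigShift v U))) (fun v => Thinning.isPhys_thin_shift hLL h2 hg v) a

/-- ★ Every member `spanTrial L′ a g Ω` of the momentum-covariant pinned trial family (physical coarse multiplier `g`, physical fine `Ω`) is a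
physical zero-flux test function on the fine torus. [cite: Luscher1983, §2] -/
theorem isPhys_spanTrial {L L' : ℕ} [NeZero L] [NeZero L'] (hLL : L' ≤ L) (h2 : L ≤ 2 * L') {g : GaugeConfig 3 L' SU2 → ℝ}
    (hg : IsPhys g) {Ω : GaugeConfig 3 L SU2 → ℝ} (hΩ : IsPhys Ω) (a : Site 3 L → ℝ) :
    IsPhys (spanTrial L' a g Ω) := by
  have hf := isPhys_spanSum hLL h2 hg a
  obtain ⟨Cf, hCf⟩ := hf.bounded
  exact IsPhys.mul_of_invariant hΩ hf.measurable hCf hf.gaugeInv hf.zeroFlux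

/-! ## The min–max door on a handed-over trial vector -/

/-- The min–max DOOR at a pair `(L′, L)` with slack `s`, for the positive normalised fine ground state `Ω` (eigen-equation in `transferApply` form):
a physical `w` with `⟨w,Ω⟩² < ‖w‖²` and `λ₁′^{L′} λ₀^{L} Var(w) ≤ e^{s} λ₀′^{L′}(⟨w,K^{L}w⟩ − λ₀^{L}⟨w,Ω⟩²)` forces
`λ₁′^{L′} λ₀^{L} ≤ e^{s} λ₁^{L} λ₀′^{L′}` (recentre `v = w − ⟨w,Ω⟩Ω`, bound `⟨v,K^{L}v⟩ ≤ λ₁^{L}‖v‖²`, cancel `‖v‖² > 0`).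
[cite: Luscher1983, §3] -/
theorem door_of_trial {L L' : ℕ} [NeZero L] [NeZero L'] {β β' s : ℝ} (hβ0 : 0 < β) {Ω : GaugeConfig 3 L SU2 → ℝ} (hΩ : IsPhys Ω)
    (hΩ1 : l2 Ω Ω = 1) (hΩeig : transferApply β Ω = topValue su2Rep L β • Ω)
    (w : GaugeConfig 3 L SU2 → ℝ) (hw : IsPhys w) (hvar : l2 w Ω ^ 2 < l2 w w)
    (hineq : secondValue su2Rep L' β' ^ L' * topValue su2Rep L β ^ L * (l2 w w - l2 w Ω ^ 2) ≤
      Real.exp s * (topValue su2Rep L' β' ^ L' * (l2 w ((transferApply β)^[L] w) - topValue su2Rep L β ^ L * l2 w Ω ^ 2))) :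
    secondValue su2Rep L' β' ^ L' * topValue su2Rep L β ^ L ≤
      Real.exp s * (secondValue su2Rep L β ^ L * topValue su2Rep L' β' ^ L') := by
  have hL1 : 1 ≤ L := NeZero.one_le
  obtain ⟨hv, hvorth, hnorm, htwo⟩ := UpStep.recentred_moments β hΩ hΩ1 hΩeig hw L
  set v : GaugeConfig 3 L SU2 → ℝ := w + (-(l2 w Ω)) • Ω with hvdef
  have hvpos : 0 < l2 v v := by rw [hnorm]; linarith
  have hcmp : secondValue su2Rep L' β' ^ L' * topValue su2Rep L β ^ L * l2 v v ≤
      Real.exp s * (topValue su2Rep L' β' ^ L' * l2 v ((transferApply β)^[L] v)) := by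
    rw [hnorm, htwo]; exact hineq
  have hvarb := UpStep.l2_iterate_le_pow_secondValue hβ0 hΩ hΩ1 hΩeig hv hvorth hL1
  have hb' : 0 ≤ topValue su2Rep L' β' ^ L' := pow_nonneg (topValue_su2Rep_pos L' β').le _
  have h1 : Real.exp s * (topValue su2Rep L' β' ^ L' * l2 v ((transferApply β)^[L] v)) ≤
      Real.exp s * (topValue su2Rep L' β' ^ L' * (secondValue su2Rep L β ^ L * l2 v v)) :=
    mul_le_mul_of_nonneg_left (mul_le_mul_of_nonneg_left hvarb hb') (Real.exp_pos _).le
  have h2' := hcmp.trans h1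
  have h3 : (secondValue su2Rep L' β' ^ L' * topValue su2Rep L β ^ L) * l2 v v ≤
      (Real.exp s * (secondValue su2Rep L β ^ L * topValue su2Rep L' β' ^ L')) * l2 v v := by
    calc (secondValue su2Rep L' β' ^ L' * topValue su2Rep L β ^ L) * l2 v v
        = secondValue su2Rep L' β' ^ L' * topValue su2Rep L β ^ L * l2 v v := by ring
      _ ≤ Real.exp s * (topValue su2Rep L' β' ^ L' * (secondValue su2Rep L β ^ L * l2 v v)) := h2'
      _ = (Real.exp s * (secondValue su2Rep L β ^ L * topValue su2Rep L' β' ^ L')) * l2 v v := by ring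
  exact le_of_mul_le_mul_right h3 hvpos

/-! ## The engines imply the cruxes -/

/-- ★★ **`PinnedSpanUnitStep → UnitUpStep`** (engine → crux stmt-QuantumFields-27556): run the min–max door on the fine ground state of
`PhysL2.exists_groundState` with the trial `ψ_a = spanTrial L′ a (φ′/Ω′) Ω` handed over by the hypothesis — neither the coefficients `a` nor any
translation invariance of `φ′` enter. [cite: Luscher1983, §3] [cite: Balaban1985Averaging, §1] -/
theorem unitUpStep_of_pinnedSpanUnitStep (h : PinnedSpanUnitStep) : UnitUpStep := by
  obtain ⟨C, lam0, hlam0, H⟩ := h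
  refine ⟨C, lam0, hlam0, fun lam hlam hle => ?_⟩
  obtain ⟨L0, HL⟩ := H lam hlam hle
  refine ⟨L0, fun L' _ hL0 β β' hW hW' hm => ?_⟩
  have hLL : L' ≤ L' + 1 := Nat.le_succ _
  have h2 : L' + 1 ≤ 2 * L' := by have := NeZero.one_le (n := L'); omega
  have hβ0 : 0 < β := zero_lt_one.trans_le hW.1
  obtain ⟨Ω, θ, c, hΩ, hc, hcle, hΩ1, hΩeig, -, -, -⟩ := PhysL2.exists_groundState (L := L' + 1) β
  have hpos : ∀ U, 0 < Ω U := fun U => hc.trans_le (hcle U)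
  obtain ⟨Ω', θ', c', hΩ', hc', hcle', hn', heig', -, -, -⟩ := PhysL2.exists_groundState (L := L') β'
  have heigp : ∀ U, ∫ V, transferKernel su2Rep β U V * Ω V ∂(configMeasure SU2 (L' + 1)) = topValue su2Rep (L' + 1) β * Ω U :=
    fun U => by simpa [transferApply] using congrFun hΩeig U
  have heigp' : ∀ U', ∫ V', transferKernel su2Rep β' U' V' * Ω' V' ∂(configMeasure SU2 L') = topValue su2Rep L' β' * Ω' U' :=
    fun U => by simpa [transferApply] using congrFun heig' U
  obtain ⟨φ', hφ', -, -, -, a, HB⟩ := HL L' hL0 β β' hW hW' hm Ω hΩ hpos hΩ1 heigp Ω' hΩ' c' hc' hcle' hn' heigp'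
  simp only [] at HB
  obtain ⟨hvar, hineq⟩ := HB
  obtain ⟨hrm, ⟨Cg, hrb⟩, hrg, hrz, -⟩ := Dirichlet.ratio_multiplier hΩ' hφ' hc' hcle'
  have hratio : IsPhys (fun U' : GaugeConfig 3 L' SU2 => φ' U' / Ω' U') := ⟨hrm, ⟨Cg, hrb⟩, hrg, hrz⟩
  have hw : IsPhys (spanTrial L' a (fun U' => φ' U' / Ω' U') Ω) := isPhys_spanTrial hLL h2 hratio hΩ a
  exact door_of_trial hβ0 hΩ hΩ1 hΩeig _ hw hvar hineq

/-- ★★ **`PinnedSpanUpStep → UpStepEv`** (engine → the shared crux stmt-QuantumFields-26796, `FlatTubeReduction` copy): the same door at every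
incommensurable pair `L′ < L < 2L′` with slack `C·Λ²`. [cite: Luscher1983, §3] [cite: Balaban1985Averaging, §1] -/
theorem upStepEv_of_pinnedSpanUpStep (h : PinnedSpanUpStep) : UpStepEv := by
  obtain ⟨C, lam0, hlam0, H⟩ := h
  refine ⟨C, lam0, hlam0, fun lam hlam hle => ?_⟩
  obtain ⟨L0, HL⟩ := H lam hlam hle
  refine ⟨L0, fun L' _ L _ hL0 hlt hlt2 β β' hW hW' hm => ?_⟩
  have hLL : L' ≤ L := hlt.le
  have h2 : L ≤ 2 * L' := hlt2.le
  have hβ0 : 0 < β := zero_lt_one.trans_le hW.1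
  obtain ⟨Ω, θ, c, hΩ, hc, hcle, hΩ1, hΩeig, -, -, -⟩ := PhysL2.exists_groundState (L := L) β
  have hpos : ∀ U, 0 < Ω U := fun U => hc.trans_le (hcle U)
  obtain ⟨Ω', θ', c', hΩ', hc', hcle', hn', heig', -, -, -⟩ := PhysL2.exists_groundState (L := L') β'
  have heigp : ∀ U, ∫ V, transferKernel su2Rep β U V * Ω V ∂(configMeasure SU2 L) = topValue su2Rep L β * Ω U :=
    fun U => by simpa [transferApply] using congrFun hΩeig U
  have heigp' : ∀ U', ∫ V', transferKernel su2Rep β' U' V' * Ω' V' ∂(configMeasure SU2 L') = topValue su2Rep L' β' * Ω' U' :=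
    fun U => by simpa [transferApply] using congrFun heig' U
  obtain ⟨φ', hφ', -, -, -, a, HB⟩ := HL L' L hL0 hlt hlt2 β β' hW hW' hm Ω hΩ hpos hΩ1 heigp Ω' hΩ' c' hc' hcle' hn' heigp'
  simp only [] at HB
  obtain ⟨hvar, hineq⟩ := HB
  obtain ⟨hrm, ⟨Cg, hrb⟩, hrg, hrz, -⟩ := Dirichlet.ratio_multiplier hΩ' hφ' hc' hcle'
  have hratio : IsPhys (fun U' : GaugeConfig 3 L' SU2 => φ' U' / Ω' U') := ⟨hrm, ⟨Cg, hrb⟩, hrg, hrz⟩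
  have hw : IsPhys (spanTrial L' a (fun U' => φ' U' / Ω' U') Ω) := isPhys_spanTrial hLL h2 hratio hΩ a
  exact door_of_trial hβ0 hΩ hΩ1 hΩeig _ hw hvar hineq

/-- By-name bridge: `PinnedSpanUpStep` gives the `FemtoCutoffLadder` copy of the shared crux `UpStepEv` (same body, shared item 26796). [folklore] -/
theorem fcl_upStepEv_of_pinnedSpanUpStep (h : PinnedSpanUpStep) : Summit.QuantumFields.YangMills.Theses.FemtoCutoffLadder.UpStepEv :=
  upStepEv_of_pinnedSpanUpStep h

/-- The full chain on the unit line: `PinnedSpanUnitStep → UpStepEv` (through `UnitLadder.upStepEv_of_unitUpStep`, telescoping inside the octave).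
[folklore] -/
theorem upStepEv_of_pinnedSpanUnitStep (h : PinnedSpanUnitStep) : UpStepEv :=
  UnitLadder.upStepEv_of_unitUpStep (unitUpStep_of_pinnedSpanUnitStep h)

/-! ## The filed engines are stronger -/

/-- The plain translation average of the filed cruxes is the member `a ≡ |Λ_L|⁻¹` of the trial family (inline thinning/shift of the items =
`thin`/`torusConfigShift` by `thin_eq_pinnedInline`, `torusConfigShift_eq_pinnedInline`). [folklore] -/
theorem spanTrial_const_eq_avg {L L' : ℕ} [NeZero L] (g : GaugeConfig 3 L' SU2 → ℝ) (Ω : GaugeConfig 3 L SU2 → ℝ) :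
    spanTrial L' (fun _ => (Fintype.card (Site 3 L) : ℝ)⁻¹) g Ω =
      fun U => ((Fintype.card (Site 3 L) : ℝ)⁻¹ * ∑ v : Site 3 L, g (thin L' (torusConfigShift v U))) * Ω U := by
  funext U
  simp only [spanTrial, Finset.mul_sum]

/-- ★ **`PinnedUnitStepEx → PinnedSpanUnitStep`**: the filed engine of crux 27561 (plain average, `a ≡ |Λ|⁻¹`) is the stronger statement.
[folklore] -/
theorem pinnedSpanUnitStep_of_pinnedUnitStepEx (h : PinnedUnitStepEx) : PinnedSpanUnitStep := by
  obtain ⟨C, lam0, hlam0, H⟩ := h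
  refine ⟨C, lam0, hlam0, fun lam hlam hle => ?_⟩
  obtain ⟨L0, HL⟩ := H lam hlam hle
  refine ⟨L0, fun L' _ hL0 β β' hW hW' hm Ω hΩ hpos hΩ1 heigp Ω' hΩ' c' hc' hcle' hn' heigp' => ?_⟩
  obtain ⟨φ', hφ', horth, hn1, heigp1, HB⟩ := HL L' hL0 β β' hW hW' hm Ω hΩ hpos hΩ1 heigp Ω' hΩ' c' hc' hcle' hn' heigp'
  simp only [] at HB
  refine ⟨φ', hφ', horth, hn1, heigp1, fun _ => (Fintype.card (Site 3 (L' + 1)) : ℝ)⁻¹, ?_⟩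
  simp only []
  rw [spanTrial_const_eq_avg]
  simp only [torusConfigShift_eq_pinnedInline, thin_eq_pinnedInline]
  exact HB

/-- ★ **`PinnedUpStepEx → PinnedSpanUpStep`**: the filed engine of crux 27379 (plain average) is the stronger statement. [folklore] -/
theorem pinnedSpanUpStep_of_pinnedUpStepEx (h : Summit.QuantumFields.YangMills.Theses.FemtoCutoffLadder.PinnedUpStepEx) :
    PinnedSpanUpStep := by
  obtain ⟨C, lam0, hlam0, H⟩ := h
  refine ⟨C, lam0, hlam0, fun lam hlam hle => ?_⟩
  obtain ⟨L0, HL⟩ := H lam hlam hle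
  refine ⟨L0, fun L' _ L _ hL0 hlt hlt2 β β' hW hW' hm Ω hΩ hpos hΩ1 heigp Ω' hΩ' c' hc' hcle' hn' heigp' => ?_⟩
  obtain ⟨φ', hφ', horth, hn1, heigp1, HB⟩ := HL L' L hL0 hlt hlt2 β β' hW hW' hm Ω hΩ hpos hΩ1 heigp Ω' hΩ' c' hc' hcle' hn' heigp'
  simp only [] at HB
  refine ⟨φ', hφ', horth, hn1, heigp1, fun _ => (Fintype.card (Site 3 L) : ℝ)⁻¹, ?_⟩
  simp only []
  rw [spanTrial_const_eq_avg]
  simp only [torusConfigShift_eq_pinnedInline, thin_eq_pinnedInline]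
  exact HB

end Summit.QuantumFields.YangMills.Theorems.FlatTubeReduction.PinnedSpan

end
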